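import Literature.NumberTheory.LFunctions.MertensErrorTermsMeanValueRHPiLiLandau
import Literature.NumberTheory.LFunctions.MertensErrorTermsMeanValueRHThm2Clause1
import Literature.NumberTheory.LFunctions.PrimeNumberTheoremQuasiRH
import HarnessLib

/-!
# Zhao 2025, Thm 2 (`1/2 < Θ < 1`): `∫₂^X E₃` changes sign infinitely often — the negative half PROVED; `Zhao2025MertensMean_thm2` DISCHARGED — RH-CONDITIONAL / conditional on a failure of RH; nothing here bears on the truth of RH

LABEL (line 1): clause 1 of the named fact is RH-CONDITIONAL, clause 2 is conditional on a FAILURE of RH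
(`1/2 < Θ < 1`); nothing in this file asserts, assumes globally, or bears on the truth of RH. Status of the
source: L. Zhao, *The Riemann hypothesis and the mean values of the error terms of Mertens' theorems*,
Res. Number Theory 11:62 (2025) = arXiv:2411.18903 (REFEREED). No endorsement is implied.

Topic `Literature/NumberTheory/LFunctions`. Everything here is PROVED; no definition, no named fact. This file
closes the last open clause of the named fact `Zhao2025MertensMean_thm2` (`MertensErrorTermsMeanValueRH.lean`):

> **Thm 2.** Let `Θ := sup{Re ρ : ζ(ρ) = 0}`. If `Θ = 1/2`, then `∫₂^X E₃(x) dx > 0` for all `X > 2`. If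
> `1/2 < Θ < 1` […], then `∫₂^X E₃(x) dx` changes sign infinitely often.

Clause 1 is the tree's `Zhao2025MertensMean_thm2_clause1` (`MertensErrorTermsMeanValueRHThm2Clause1.lean`); the
positive half of clause 2 is `Zhao2025.thm2_clause2_pos_of_not_RH` (`MertensErrorTermsMeanValueRHPiLiLandau.lean`,
from a failure of RH alone). The NEGATIVE half («`∫₂^X E₃ < 0` beyond every `X₀`», under `¬RH` and a zero-free strip
`Re ρ ≤ 1 − δ`, the typing of `Θ < 1`) is proved here, following the source's §4 (p. 8, «We are now ready to prove
Theorem 2 in the case where `1/2 ≤ Θ < 1`») in the variant the source itself offers on p. 7: «for our purposes it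
suffices to trivially bound `∫₂^X (E₂(x))² dx` by inserting classical bounds such as
`ψ(x) − x = O(x^Θ (log x)²)` and `π(x) − li(x) = O(x^Θ log x)` [(4.1)] into the integral» — i.e. WITHOUT the
mean-square Lemmas 8–9, whose «full strength … will not necessarily be needed».

**Proof.** Let `S = {Re ρ : ζ(ρ) = 0, 1/2 < Re ρ < 1}` (non-empty by `¬RH`, `Zhao2025.exists_zero_of_not_RH`;
bounded by `1 − δ`) and `Θ = sup S ∈ (1/2, 1)`; then `ζ(s) ≠ 0` for `Θ < Re s < 1` (`QuasiRiemannHypothesis Θ`).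
1. (4.1) ⟹ `E₂(x) ≪ x^{Θ−1+η}` (`Zhao2025.abs_E₂_le_rpow_of_quasiRH`): by (2.4)
   (`Zhao2025.E₂_eq_primeCounting_sub_li`) `E₂ = (π − li)/x − ∫_x^∞ (π − li)/t²`, with
   `|π(t) − li(t)| ≤ C t^Θ log t ≤ (C/η) t^{Θ+η}` (`QuasiRHPNT.abs_primeCounting_sub_logIntegral_le`,
   Montgomery–Vaughan §13.1.1 Ex. 1, `PrimeNumberTheoremQuasiRH.lean`) and `∫_x^∞ t^{Θ+η−2} dt = x^{Θ+η−1}/(1−Θ−η)`.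
2. `∫₂^X E₃ ≤ A + e^γ ∫₂^X E₂ + K X^{2Θ−1+2η}` for `X ≥ x₁` (`Zhao2025.integral_E₃_le_of_quasiRH`): the source's
   first display of §4, `∫₂^X E₃ = e^γ ∫₂^X (e^{E₂} − 1)` — in the tree with the tail `δ(x) ∈ [0, 2/x]` made explicit,
   `E₃ = e^γ(exp(E₂ − δ) − 1)` (`Zhao2025.E₃_eq_exp`) — and `eᵘ − 1 ≤ u + u²` for `|u| ≤ 1` (Mathlib
   `Real.abs_exp_sub_one_sub_id_le`; the source's `Σ_{n≥2} (E₂)ⁿ/n! ≪ X^{2Θ−1}`), `u = E₂ − δ`, `|u| ≤ (C+2)x^{Θ−1+η} ≤ 1`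
   for `x ≥ x₁`, integrated over `[x₁, X]` (`∫ x^{2Θ−2+2η} ≤ X^{2Θ−1+2η}/(2Θ−1+2η)`).
3. Landau's theorem with rate, `∫₂^X E₂ < −X^c` for arbitrarily large `X` for every `c < Re ρ₁` at a zero `ρ₁` off
   the line (the tree's `Zhao2025.frequently_integral_E₂_lt_neg_rpow_of_zero`, the source's (3.1) `Ω₋(X^{Θ−ε})`):
   with `η = (1 − Θ)/5`, a zero `ρ₁` with `Re ρ₁ > Θ − η` and `c = Θ − 2η > 2Θ − 1 + 2η` («choosing `ε < 1 − Θ`»),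
   `A + K X^{2Θ−1+2η} < e^γ X^c` eventually, whence `∫₂^X E₃ < 0` for arbitrarily large `X`
   (`Zhao2025.frequently_integral_E₃_lt_zero_of_not_RH`, `Zhao2025.thm2_clause2_neg_of_not_RH`).
Assembly: `Zhao2025MertensMean_thm2_holds`. The printed third case (`Θ = 1` under Assumption 1, §5, Pintz's
method) is not part of the typed fact and is not touched.

## Main results

* `Zhao2025.abs_E₂_le_rpow_of_quasiRH`, `Zhao2025.integral_E₃_le_of_quasiRH` (steps 1–2, under `QuasiRiemannHypothesis Θ`);
* `Zhao2025.frequently_integral_E₃_lt_zero_of_not_RH`, `Zhao2025.thm2_clause2_neg_of_not_RH`,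
  `Zhao2025.integral_E₃_changes_sign_of_not_RH` (clause 2 complete);
* `Zhao2025MertensMean_thm2_holds : Zhao2025MertensMean_thm2` — the named fact DISCHARGED.

## References

* [Zhao2025MertensMean] L. Zhao, Res. Number Theory 11 (2025) 62, arXiv:2411.18903: Thm 2, §4 (pp. 7–8), (2.4), (3.1), (4.1).
* [MontgomeryVaughan2007] H. L. Montgomery, R. C. Vaughan, *Multiplicative Number Theory I*, CUP 2007: §13.1.1
  Exercise 1; §15.1 (Thm. 15.2 and its proof: Landau's theorem).
-/

noncomputable section

open Filter Topology Set MeasureTheory Asymptotics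
open scoped Real Chebyshev

namespace Literature.NumberTheory.LFunctions

namespace Zhao2025

/-! ### Step 1: (4.1) ⟹ `E₂(x) ≪ x^{Θ−1+η}` -/

/-- **`E₂(x) = O(x^{Θ−1+η})` under a zero-free half-plane `σ > Θ`** (`1/2 ≤ Θ`, `0 < η`, `Θ + η < 1`): there is
`C > 0` with `|E₂(x)| ≤ C x^{Θ−1+η}` for all `x ≥ 2` — (2.4) with the classical bound (4.1)
`π(x) − li(x) = O(x^Θ log x)` «inserted into the integral» and `log t ≤ t^η/η`.
[cite: Zhao2025MertensMean, §4 (4.1) with §2 (2.4)] -/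
theorem abs_E₂_le_rpow_of_quasiRH {Θ η : ℝ} (hQ : QuasiRiemannHypothesis Θ) (hΘ : 1 / 2 ≤ Θ)
    (hη : 0 < η) (hΘη : Θ + η < 1) :
    ∃ C : ℝ, 0 < C ∧ ∀ x : ℝ, 2 ≤ x → |E₂ x| ≤ C * x ^ (Θ - 1 + η) := by
  obtain ⟨C, hC0, hC⟩ := QuasiRHPNT.abs_primeCounting_sub_logIntegral_le hQ hΘ
  have h1Θη : 0 < 1 - Θ - η := by linarith
  refine ⟨C / η * (1 + 1 / (1 - Θ - η)), by positivity, fun x hx ↦ ?_⟩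
  have hx0 : 0 < x := by linarith
  -- pointwise: `|π(t) − li(t)| ≤ (C/η) t^{Θ+η}` for `t ≥ 2`
  have hpt : ∀ t : ℝ, 2 ≤ t →
      |(Nat.primeCounting ⌊t⌋₊ : ℝ) - logIntegral t| ≤ C / η * t ^ (Θ + η) := by
    intro t ht
    have ht0 : 0 < t := by linarith
    have hlog : Real.log t ≤ t ^ η / η := Real.log_le_rpow_div ht0.le hη
    have htΘ : 0 ≤ C * t ^ Θ := mul_nonneg hC0.le (Real.rpow_nonneg ht0.le _)
    calc |(Nat.primeCounting ⌊t⌋₊ : ℝ) - logIntegral t| ≤ C * t ^ Θ * Real.log t := hC t ht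
      _ ≤ C * t ^ Θ * (t ^ η / η) := mul_le_mul_of_nonneg_left hlog htΘ
      _ = C / η * (t ^ Θ * t ^ η) := by ring
      _ = C / η * t ^ (Θ + η) := by rw [← Real.rpow_add ht0]
  -- the boundary term `(π(x) − li(x))/x`
  have hA : |((Nat.primeCounting ⌊x⌋₊ : ℝ) - logIntegral x) / x| ≤ C / η * x ^ (Θ - 1 + η) := by
    rw [abs_div, abs_of_pos hx0, div_le_iff₀ hx0]
    calc |(Nat.primeCounting ⌊x⌋₊ : ℝ) - logIntegral x| ≤ C / η * x ^ (Θ + η) := hpt x hx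
      _ = C / η * x ^ (Θ - 1 + η) * x := by
          rw [show Θ + η = (Θ - 1 + η) + 1 by ring, Real.rpow_add_one hx0.ne']; ring
  -- the tail integral `∫_x^∞ (π − li)/t²`
  have hB : |∫ t in Ioi x, ((Nat.primeCounting ⌊t⌋₊ : ℝ) - logIntegral t) / t ^ 2| ≤
      C / η * (1 / (1 - Θ - η)) * x ^ (Θ - 1 + η) := by
    have hexp : Θ + η - 2 < -1 := by linarith
    have hgi : Integrable (fun t : ℝ ↦ C / η * t ^ (Θ + η - 2)) (volume.restrict (Ioi x)) :=
      (integrableOn_Ioi_rpow_of_lt hexp hx0).const_mul _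
    have hle : ∀ᵐ t ∂(volume.restrict (Ioi x)),
        ‖((Nat.primeCounting ⌊t⌋₊ : ℝ) - logIntegral t) / t ^ 2‖ ≤ C / η * t ^ (Θ + η - 2) := by
      rw [ae_restrict_iff' measurableSet_Ioi]
      refine Eventually.of_forall fun t ht ↦ ?_
      have ht2 : 2 ≤ t := hx.trans (le_of_lt ht)
      have ht0 : 0 < t := by linarith
      rw [Real.norm_eq_abs, abs_div, abs_of_pos (by positivity : (0 : ℝ) < t ^ 2),
        div_le_iff₀ (by positivity)]
      calc |(Nat.primeCounting ⌊t⌋₊ : ℝ) - logIntegral t| ≤ C / η * t ^ (Θ + η) := hpt t ht2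
        _ = C / η * t ^ (Θ + η - 2) * t ^ 2 := by
            rw [show Θ + η = (Θ + η - 2) + 2 by ring, Real.rpow_add ht0, Real.rpow_two]; ring
    have h1 := norm_integral_le_of_norm_le hgi hle
    rw [Real.norm_eq_abs] at h1
    refine h1.trans ?_
    rw [integral_const_mul, integral_Ioi_rpow_of_lt hexp hx0,
      show Θ + η - 2 + 1 = Θ - 1 + η by ring]
    have hne : Θ - 1 + η ≠ 0 := (by linarith : Θ - 1 + η < 0).ne
    have hne' : 1 - Θ - η ≠ 0 := h1Θη.ne'
    have e : -x ^ (Θ - 1 + η) / (Θ - 1 + η) = 1 / (1 - Θ - η) * x ^ (Θ - 1 + η) := by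
      field_simp
      ring
    rw [e]
    exact le_of_eq (by ring)
  rw [E₂_eq_primeCounting_sub_li hx]
  calc |((Nat.primeCounting ⌊x⌋₊ : ℝ) - logIntegral x) / x -
        ∫ t in Ioi x, ((Nat.primeCounting ⌊t⌋₊ : ℝ) - logIntegral t) / t ^ 2|
      ≤ |((Nat.primeCounting ⌊x⌋₊ : ℝ) - logIntegral x) / x| +
          |∫ t in Ioi x, ((Nat.primeCounting ⌊t⌋₊ : ℝ) - logIntegral t) / t ^ 2| := abs_sub _ _
    _ ≤ C / η * x ^ (Θ - 1 + η) + C / η * (1 / (1 - Θ - η)) * x ^ (Θ - 1 + η) := add_le_add hA hB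
    _ = C / η * (1 + 1 / (1 - Θ - η)) * x ^ (Θ - 1 + η) := by ring

/-! ### Step 2: `∫₂^X E₃ ≤ A + e^γ ∫₂^X E₂ + K X^{2Θ−1+2η}` -/

/-- **The first moment dominates up to the square term**: under a zero-free half-plane `σ > Θ`
(`1/2 ≤ Θ`, `0 < η`, `Θ + η < 1`) there are `A`, `K > 0` and `x₁ ≥ 2` with
`∫₂^X E₃ ≤ A + e^γ ∫₂^X E₂ + K X^{2Θ−1+2η}` for all `X ≥ x₁` — the source's
`∫₂^X E₃ = e^γ ∫₂^X E₂ + e^γ Σ_{n≥2} (1/n!) ∫₂^X E₂ⁿ` with `Σ_{n≥2} … ≪ X^{2Θ−1}`, here via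
`eᵘ − 1 ≤ u + u²` (`|u| ≤ 1`), `u = E₂ − δ`, `0 ≤ δ ≤ 2/x`, `|u| ≤ (C + 2) x^{Θ−1+η}`.
[cite: Zhao2025MertensMean, §4 (proof of Thm 2, case 1/2 ≤ Θ < 1)] -/
theorem integral_E₃_le_of_quasiRH {Θ η : ℝ} (hQ : QuasiRiemannHypothesis Θ) (hΘ : 1 / 2 ≤ Θ)
    (hη : 0 < η) (hΘη : Θ + η < 1) :
    ∃ A K x₁ : ℝ, 0 < K ∧ 2 ≤ x₁ ∧ ∀ X : ℝ, x₁ ≤ X →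
      ∫ x in (2 : ℝ)..X, E₃ x ≤
        A + Real.exp Real.eulerMascheroniConstant * (∫ x in (2 : ℝ)..X, E₂ x) +
          K * X ^ (2 * Θ - 1 + 2 * η) := by
  obtain ⟨C, hC0, hC⟩ := abs_E₂_le_rpow_of_quasiRH hQ hΘ hη hΘη
  set a : ℝ := Θ - 1 + η with ha
  have ha0 : a < 0 := by rw [ha]; linarith
  have ha1 : -1 < a := by rw [ha]; linarith
  set b : ℝ := 2 * Θ - 1 + 2 * η with hb
  have hb0 : 0 < b := by rw [hb]; linarith
  have hab : 2 * a + 1 = b := by rw [ha, hb]; ring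
  have h2a : -1 < 2 * a := by linarith
  have hγ0 : 0 < Real.exp Real.eulerMascheroniConstant := Real.exp_pos _
  -- `(C + 2) x^a → 0`: an `x₁ ≥ 2` with `(C + 2) x^a ≤ 1` beyond it
  have hev : ∀ᶠ x : ℝ in atTop, (C + 2) * x ^ a ≤ 1 := by
    have ht : Tendsto (fun x : ℝ ↦ (C + 2) * x ^ a) atTop (𝓝 ((C + 2) * 0)) := by
      have h0 := tendsto_rpow_neg_atTop (by linarith : 0 < -a)
      simp only [neg_neg] at h0
      exact h0.const_mul _
    rw [mul_zero] at ht
    exact (ht.eventually (gt_mem_nhds zero_lt_one)).mono fun x hx ↦ hx.le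
  obtain ⟨x₀, hx₀⟩ := hev.exists_forall_of_atTop
  set x₁ : ℝ := max x₀ 2 with hx₁
  have hx₁2 : 2 ≤ x₁ := le_max_right _ _
  have hsmall : ∀ x : ℝ, x₁ ≤ x → (C + 2) * x ^ a ≤ 1 := fun x hx ↦ hx₀ x ((le_max_left _ _).trans hx)
  refine ⟨(∫ x in (2 : ℝ)..x₁, E₃ x) - Real.exp Real.eulerMascheroniConstant * ∫ x in (2 : ℝ)..x₁, E₂ x,
    Real.exp Real.eulerMascheroniConstant * (C + 2) ^ 2 / b, x₁, by positivity, hx₁2, fun X hX ↦ ?_⟩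
  -- pointwise on `[x₁, X]`: `E₃ ≤ e^γ (E₂ + (C+2)² x^{2a})`
  have hpt : ∀ x ∈ Icc x₁ X,
      E₃ x ≤ Real.exp Real.eulerMascheroniConstant * (E₂ x + (C + 2) ^ 2 * x ^ (2 * a)) := by
    intro x hx
    have hxx₁ : x₁ ≤ x := hx.1
    have hx2 : 2 ≤ x := hx₁2.trans hxx₁
    have hx0 : 0 < x := by linarith
    have hx1 : 1 ≤ x := by linarith
    rw [E₃_eq_exp (by linarith : 1 < x)]
    set δ : ℝ := ∑' i : ℕ, Mertens.primeLogCoeffSubInv (i + (⌊x⌋₊ + 1)) with hδ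
    have hδ0 : 0 ≤ δ := primeLogTail_nonneg x
    have hδ2 : δ ≤ 2 / x := primeLogTail_le_two_div hx2
    have hxa : x⁻¹ ≤ x ^ a := by
      rw [← Real.rpow_neg_one]
      exact Real.rpow_le_rpow_of_exponent_le hx1 ha1.le
    have h2x : 2 / x ≤ 2 * x ^ a := by
      rw [div_eq_mul_inv]
      exact mul_le_mul_of_nonneg_left hxa (by norm_num)
    have hE := abs_le.1 (hC x hx2)
    set u : ℝ := E₂ x - δ with hu
    have hu_abs : |u| ≤ (C + 2) * x ^ a := by
      rw [hu, abs_le]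
      constructor
      · nlinarith [hE.1]
      · nlinarith [hE.2]
    have hu1 : |u| ≤ 1 := hu_abs.trans (hsmall x hxx₁)
    have hexp : Real.exp u - 1 ≤ u + u ^ 2 := by
      have := (abs_le.1 (Real.abs_exp_sub_one_sub_id_le hu1)).2
      linarith
    have hu_le : u ≤ E₂ x := by rw [hu]; linarith
    have hu_sq : u ^ 2 ≤ ((C + 2) * x ^ a) ^ 2 := by
      rw [← sq_abs]
      exact pow_le_pow_left₀ (abs_nonneg _) hu_abs 2
    have hsq : x ^ (2 * a) = (x ^ a) ^ 2 := by
      rw [show (2 : ℝ) * a = a * 2 by ring, Real.rpow_mul hx0.le, Real.rpow_two]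
    refine mul_le_mul_of_nonneg_left ?_ hγ0.le
    rw [hsq, ← mul_pow]
    linarith
  -- integrate over `[x₁, X]`
  have hI₃ : IntervalIntegrable E₃ volume x₁ X := intervalIntegrable_E₃ hx₁2 hX
  have hI₂ : IntervalIntegrable E₂ volume x₁ X := intervalIntegrable_E₂ hx₁2 hX
  have hIpow : IntervalIntegrable (fun x : ℝ ↦ x ^ (2 * a)) volume x₁ X :=
    intervalIntegral.intervalIntegrable_rpow' h2a
  have hIrhs : IntervalIntegrable
      (fun x ↦ Real.exp Real.eulerMascheroniConstant * (E₂ x + (C + 2) ^ 2 * x ^ (2 * a))) volume x₁ X :=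
    (hI₂.add (hIpow.const_mul _)).const_mul _
  have hmono := intervalIntegral.integral_mono_on hX hI₃ hIrhs hpt
  have hrhs : (∫ x in x₁..X, Real.exp Real.eulerMascheroniConstant * (E₂ x + (C + 2) ^ 2 * x ^ (2 * a))) =
      Real.exp Real.eulerMascheroniConstant *
        ((∫ x in x₁..X, E₂ x) + (C + 2) ^ 2 * ∫ x in x₁..X, x ^ (2 * a)) := by
    rw [intervalIntegral.integral_const_mul, intervalIntegral.integral_add hI₂ (hIpow.const_mul _),
      intervalIntegral.integral_const_mul]
  rw [hrhs] at hmono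
  have hpow : ∫ x in x₁..X, x ^ (2 * a) ≤ X ^ b / b := by
    rw [integral_rpow (Or.inl h2a), hab]
    have : 0 ≤ x₁ ^ b := Real.rpow_nonneg (by linarith) _
    exact div_le_div_of_nonneg_right (by linarith) hb0.le
  have hK : Real.exp Real.eulerMascheroniConstant * ((C + 2) ^ 2 * ∫ x in x₁..X, x ^ (2 * a)) ≤
      Real.exp Real.eulerMascheroniConstant * (C + 2) ^ 2 / b * X ^ b := by
    have h := mul_le_mul_of_nonneg_left hpow
      (by positivity : 0 ≤ Real.exp Real.eulerMascheroniConstant * (C + 2) ^ 2)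
    calc Real.exp Real.eulerMascheroniConstant * ((C + 2) ^ 2 * ∫ x in x₁..X, x ^ (2 * a))
        = Real.exp Real.eulerMascheroniConstant * (C + 2) ^ 2 * ∫ x in x₁..X, x ^ (2 * a) := by ring
      _ ≤ Real.exp Real.eulerMascheroniConstant * (C + 2) ^ 2 * (X ^ b / b) := h
      _ = Real.exp Real.eulerMascheroniConstant * (C + 2) ^ 2 / b * X ^ b := by ring
  -- split `∫₂^X` at `x₁`
  have hsplit₃ : ∫ x in (2 : ℝ)..X, E₃ x = (∫ x in (2 : ℝ)..x₁, E₃ x) + ∫ x in x₁..X, E₃ x :=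
    (intervalIntegral.integral_add_adjacent_intervals (intervalIntegrable_E₃ le_rfl hx₁2) hI₃).symm
  have hsplit₂ : ∫ x in (2 : ℝ)..X, E₂ x = (∫ x in (2 : ℝ)..x₁, E₂ x) + ∫ x in x₁..X, E₂ x :=
    (intervalIntegral.integral_add_adjacent_intervals (intervalIntegrable_E₂ le_rfl hx₁2) hI₂).symm
  rw [hsplit₃, hsplit₂]
  linarith [hmono, hK]

/-! ### Step 3: Landau's `Ω±(X^{Θ−ε})` beats `X^{2Θ−1+2η}` when `Θ < 1` -/

/-- **`∫₂^X E₃ = Ω₋(X^{Θ−ε})` for `1/2 < Θ < 1`, zero by zero**: if the non-trivial zeros satisfy `Re ρ ≤ 1 − δ`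
for some `δ > 0`, `ζ(ρ₀) = 0` with `Re ρ₀ > 1/2` and `c < Re ρ₀`, then `∫₂^X E₃(x) dx < −X^c` for arbitrarily large `X`.
With `S = {Re ρ : ζ(ρ) = 0, 1/2 < Re ρ < 1}`, `Θ = sup S ∈ (1/2, 1)`, `η = (1 − Θ)/5`, `b = 2Θ − 1 + 2η < Θ`, a zero `ρ₁`
with `Re ρ₁ > c₂ := (max(b, c) + Θ)/2`: `∫₂^X E₂ < −X^{c₂}` for arbitrarily large `X` (Landau, (3.1)) while
`∫₂^X E₃ ≤ A + e^γ ∫₂^X E₂ + K X^b` and `A + K X^b + X^c < e^γ X^{c₂}` eventually («choosing `ε < 1 − Θ`»).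
[cite: Zhao2025MertensMean, Thm 2 and §4 («∫₂^X E₃ = Ω±(X^{Θ−ε})», case 1/2 < Θ < 1)] -/
theorem frequently_integral_E₃_lt_neg_rpow_of_zero
    (hstrip : ∃ δ : ℝ, 0 < δ ∧ ∀ ρ : ℂ, riemannZeta ρ = 0 → 0 < ρ.re → ρ.re < 1 → ρ.re ≤ 1 - δ)
    {ρ₀ : ℂ} (hζ₀ : riemannZeta ρ₀ = 0) (hρ₀ : 1 / 2 < ρ₀.re) {c : ℝ} (hc : c < ρ₀.re) :
    ∃ᶠ X : ℝ in atTop, ∫ x in (2 : ℝ)..X, E₃ x < -X ^ c := by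
  obtain ⟨δ, hδ0, hδ⟩ := hstrip
  have hρ₀1 : ρ₀.re < 1 := by
    by_contra h
    exact riemannZeta_ne_zero_of_one_le_re (not_lt.1 h) hζ₀
  -- `Θ = sup` of the real parts of the zeros to the right of the critical line
  set S : Set ℝ := (fun ρ : ℂ ↦ ρ.re) '' {ρ : ℂ | riemannZeta ρ = 0 ∧ 1 / 2 < ρ.re ∧ ρ.re < 1} with hS
  have hmem₀ : ρ₀.re ∈ S := ⟨ρ₀, ⟨hζ₀, hρ₀, hρ₀1⟩, rfl⟩
  have hne : S.Nonempty := ⟨_, hmem₀⟩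
  have hbdd' : ∀ β ∈ S, β ≤ 1 - δ := by
    rintro β ⟨ρ, ⟨hζ, h1, h2⟩, rfl⟩
    exact hδ ρ hζ (by linarith) h2
  have hbdd : BddAbove S := ⟨1 - δ, hbdd'⟩
  set Θ : ℝ := sSup S with hΘ
  have hΘge : ρ₀.re ≤ Θ := le_csSup hbdd hmem₀
  have hΘhalf : 1 / 2 < Θ := lt_of_lt_of_le hρ₀ hΘge
  have hΘ1 : Θ < 1 := lt_of_le_of_lt (csSup_le hne hbdd') (by linarith)
  have hQ : QuasiRiemannHypothesis Θ := by
    intro s hs h1 h2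
    have hsS : s.re ∈ S := ⟨s, ⟨hs, by linarith, h2⟩, rfl⟩
    exact absurd (le_csSup hbdd hsS) (not_le.2 h1)
  -- parameters `η = (1 − Θ)/5`, `b = 2Θ − 1 + 2η < Θ`, `c₂ = (max(b, c) + Θ)/2`
  set η : ℝ := (1 - Θ) / 5 with hη
  have hη0 : 0 < η := by rw [hη]; linarith
  have hΘη : Θ + η < 1 := by rw [hη]; linarith
  set b : ℝ := 2 * Θ - 1 + 2 * η with hb
  have hb0 : 0 < b := by rw [hb]; linarith
  have hbΘ : b < Θ := by rw [hb, hη]; linarith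
  have hcΘ : c < Θ := lt_of_lt_of_le hc hΘge
  have hc₁ : max b c < Θ := max_lt hbΘ hcΘ
  set c₂ : ℝ := (max b c + Θ) / 2 with hc₂def
  have hc₂Θ : c₂ < Θ := by rw [hc₂def]; linarith
  have hbc₂ : b < c₂ := by have := le_max_left b c; rw [hc₂def]; linarith
  have hcc₂ : c < c₂ := by have := le_max_right b c; rw [hc₂def]; linarith
  have hc₂0 : 0 < c₂ := hb0.trans hbc₂
  -- a zero `ρ₁` with `Re ρ₁ > c₂`
  obtain ⟨β, ⟨ρ₁, ⟨hζ₁, hρ₁, -⟩, rfl⟩, hβ⟩ := exists_lt_of_lt_csSup hne hc₂Θ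
  have hc₂ρ : c₂ < ρ₁.re := by simpa using hβ
  -- Landau with rate: `∫₂^X E₂ < −X^{c₂}` frequently
  have hLandau := frequently_integral_E₂_lt_neg_rpow_of_zero hζ₁ hρ₁ hc₂ρ
  -- the upper bound of Step 2
  obtain ⟨A, K, x₁, hK0, hx₁2, hup⟩ := integral_E₃_le_of_quasiRH hQ hΘhalf.le hη0 hΘη
  have hγ : 0 < Real.exp Real.eulerMascheroniConstant := Real.exp_pos _
  -- eventually `A + K X^b + X^c < e^γ X^{c₂}`
  have hev : ∀ᶠ X : ℝ in atTop,
      A + K * X ^ b + X ^ c < Real.exp Real.eulerMascheroniConstant * X ^ c₂ ∧ x₁ ≤ X := by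
    have ht : Tendsto (fun X : ℝ ↦ |A| * X ^ (-c₂) + K * X ^ (-(c₂ - b)) + X ^ (-(c₂ - c))) atTop
        (𝓝 (|A| * 0 + K * 0 + 0)) :=
      (((tendsto_rpow_neg_atTop hc₂0).const_mul _).add
        ((tendsto_rpow_neg_atTop (by linarith : 0 < c₂ - b)).const_mul _)).add
        (tendsto_rpow_neg_atTop (by linarith : 0 < c₂ - c))
    rw [mul_zero, mul_zero, add_zero, add_zero] at ht
    filter_upwards [ht.eventually (gt_mem_nhds hγ), eventually_ge_atTop x₁,
      eventually_gt_atTop (0 : ℝ)] with X hX hX₁ hX0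
    refine ⟨?_, hX₁⟩
    have hXc : 0 < X ^ c₂ := Real.rpow_pos_of_pos hX0 _
    have e1 : X ^ c₂ * X ^ (-c₂) = 1 := by
      rw [← Real.rpow_add hX0, add_neg_cancel, Real.rpow_zero]
    have e2 : X ^ c₂ * X ^ (-(c₂ - b)) = X ^ b := by
      rw [← Real.rpow_add hX0]
      congr 1
      ring
    have e3 : X ^ c₂ * X ^ (-(c₂ - c)) = X ^ c := by
      rw [← Real.rpow_add hX0]
      congr 1
      ring
    have h3 : X ^ c₂ * (|A| * X ^ (-c₂) + K * X ^ (-(c₂ - b)) + X ^ (-(c₂ - c))) <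
        X ^ c₂ * Real.exp Real.eulerMascheroniConstant := mul_lt_mul_of_pos_left hX hXc
    have h4 : X ^ c₂ * (|A| * X ^ (-c₂) + K * X ^ (-(c₂ - b)) + X ^ (-(c₂ - c))) =
        |A| + K * X ^ b + X ^ c := by
      calc X ^ c₂ * (|A| * X ^ (-c₂) + K * X ^ (-(c₂ - b)) + X ^ (-(c₂ - c)))
          = |A| * (X ^ c₂ * X ^ (-c₂)) + K * (X ^ c₂ * X ^ (-(c₂ - b))) +
              X ^ c₂ * X ^ (-(c₂ - c)) := by ring
        _ = |A| + K * X ^ b + X ^ c := by rw [e1, e2, e3, mul_one]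
    rw [h4] at h3
    have hA : A ≤ |A| := le_abs_self A
    linarith
  refine (hLandau.and_eventually hev).mono ?_
  rintro X ⟨hX, hlt, hX₁⟩
  have h1 := hup X hX₁
  have h2 : Real.exp Real.eulerMascheroniConstant * (∫ x in (2 : ℝ)..X, E₂ x) <
      Real.exp Real.eulerMascheroniConstant * (-X ^ c₂) := mul_lt_mul_of_pos_left hX hγ
  linarith

/-- **`∫₂^X E₃ = Ω₊(X^{Θ−ε})`, zero by zero, from ANY zero off the line** (no zero-free strip needed): if
`ζ(ρ₀) = 0` with `Re ρ₀ > 1/2` and `c < Re ρ₀`, then `∫₂^X E₃(x) dx > X^c` for arbitrarily large `X`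
(`∫₂^X E₃ ≥ e^γ(∫₂^X E₂ − 2 log(X/2))`, `Zhao2025.integral_E₃_ge`, and `∫₂^X E₂ > X^{c₂}` frequently for
`c₂ ∈ (max(c, 0), Re ρ₀)`, `Zhao2025.frequently_rpow_lt_integral_E₂_of_zero`).
[cite: Zhao2025MertensMean, Thm 2 and §4 («∫₂^X E₃ = Ω±(X^{Θ−ε})»)] -/
theorem frequently_rpow_lt_integral_E₃_of_zero {ρ₀ : ℂ} (hζ₀ : riemannZeta ρ₀ = 0) (hρ₀ : 1 / 2 < ρ₀.re)
    {c : ℝ} (hc : c < ρ₀.re) : ∃ᶠ X : ℝ in atTop, X ^ c < ∫ x in (2 : ℝ)..X, E₃ x := by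
  set c₂ : ℝ := (max c 0 + ρ₀.re) / 2 with hc₂def
  have hm : max c 0 < ρ₀.re := max_lt hc (by linarith)
  have hc₂ρ : c₂ < ρ₀.re := by rw [hc₂def]; linarith
  have hcc₂ : c < c₂ := by have := le_max_left c 0; rw [hc₂def]; linarith
  have hc₂0 : 0 < c₂ := by have := le_max_right c 0; rw [hc₂def]; linarith
  have h1 := frequently_rpow_lt_integral_E₂_of_zero hζ₀ hρ₀ hc₂ρ
  have hγ : 0 < Real.exp Real.eulerMascheroniConstant := Real.exp_pos _
  -- eventually `X^c + 2 e^γ log(X/2) < e^γ X^{c₂}`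
  have hev : ∀ᶠ X : ℝ in atTop,
      X ^ c + 2 * Real.exp Real.eulerMascheroniConstant * Real.log (X / 2) <
        Real.exp Real.eulerMascheroniConstant * X ^ c₂ ∧ 2 ≤ X := by
    have hc₂2 : 0 < c₂ / 2 := by linarith
    have ht : Tendsto (fun X : ℝ ↦ X ^ (-(c₂ - c)) +
        2 * Real.exp Real.eulerMascheroniConstant * (2 / c₂) * X ^ (-(c₂ / 2))) atTop
        (𝓝 (0 + 2 * Real.exp Real.eulerMascheroniConstant * (2 / c₂) * 0)) :=
      (tendsto_rpow_neg_atTop (by linarith : 0 < c₂ - c)).add ((tendsto_rpow_neg_atTop hc₂2).const_mul _)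
    rw [mul_zero, add_zero] at ht
    filter_upwards [ht.eventually (gt_mem_nhds hγ), eventually_ge_atTop (2 : ℝ)] with X hX hX2
    refine ⟨?_, hX2⟩
    have hX0 : 0 < X := by linarith
    have hXc : 0 < X ^ c₂ := Real.rpow_pos_of_pos hX0 _
    have e1 : X ^ c₂ * X ^ (-(c₂ - c)) = X ^ c := by
      rw [← Real.rpow_add hX0]
      congr 1
      ring
    have e2 : X ^ c₂ * X ^ (-(c₂ / 2)) = X ^ (c₂ / 2) := by
      rw [← Real.rpow_add hX0]
      congr 1
      ring
    -- `log(X/2) ≤ log X ≤ X^{c₂/2}/(c₂/2) = (2/c₂) X^{c₂/2}`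
    have hlog : Real.log (X / 2) ≤ 2 / c₂ * X ^ (c₂ / 2) := by
      have h1 : Real.log (X / 2) ≤ Real.log X := Real.log_le_log (by linarith) (by linarith)
      have h2 : Real.log X ≤ X ^ (c₂ / 2) / (c₂ / 2) := Real.log_le_rpow_div hX0.le hc₂2
      rw [div_div_eq_mul_div] at h2
      calc Real.log (X / 2) ≤ Real.log X := h1
        _ ≤ X ^ (c₂ / 2) * 2 / c₂ := h2
        _ = 2 / c₂ * X ^ (c₂ / 2) := by ring
    have h3 : X ^ c₂ * (X ^ (-(c₂ - c)) +
        2 * Real.exp Real.eulerMascheroniConstant * (2 / c₂) * X ^ (-(c₂ / 2))) <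
        X ^ c₂ * Real.exp Real.eulerMascheroniConstant := mul_lt_mul_of_pos_left hX hXc
    have h4 : X ^ c₂ * (X ^ (-(c₂ - c)) +
        2 * Real.exp Real.eulerMascheroniConstant * (2 / c₂) * X ^ (-(c₂ / 2))) =
        X ^ c + 2 * Real.exp Real.eulerMascheroniConstant * (2 / c₂ * X ^ (c₂ / 2)) := by
      calc X ^ c₂ * (X ^ (-(c₂ - c)) +
            2 * Real.exp Real.eulerMascheroniConstant * (2 / c₂) * X ^ (-(c₂ / 2)))
          = X ^ c₂ * X ^ (-(c₂ - c)) +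
              2 * Real.exp Real.eulerMascheroniConstant * (2 / c₂) * (X ^ c₂ * X ^ (-(c₂ / 2))) := by ring
        _ = X ^ c + 2 * Real.exp Real.eulerMascheroniConstant * (2 / c₂ * X ^ (c₂ / 2)) := by
            rw [e1, e2]; ring
    rw [h4] at h3
    have h5 : 2 * Real.exp Real.eulerMascheroniConstant * Real.log (X / 2) ≤
        2 * Real.exp Real.eulerMascheroniConstant * (2 / c₂ * X ^ (c₂ / 2)) :=
      mul_le_mul_of_nonneg_left hlog (by positivity)
    linarith
  refine (h1.and_eventually hev).mono ?_
  rintro X ⟨hX, hlt, hX2⟩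
  have h2 := integral_E₃_ge hX2
  have h3 : Real.exp Real.eulerMascheroniConstant * X ^ c₂ <
      Real.exp Real.eulerMascheroniConstant * ∫ x in (2 : ℝ)..X, E₂ x := mul_lt_mul_of_pos_left hX hγ
  linarith

/-- **Thm 2 (`1/2 < Θ < 1`), negative half, `Filter` form**: if RH fails and the non-trivial zeros satisfy
`Re ρ ≤ 1 − δ` for some `δ > 0`, then `∫₂^X E₃(x) dx < 0` for arbitrarily large `X` (the previous `Ω₋` statement at a
zero `ρ₀` off the line, `Zhao2025.exists_zero_of_not_RH`, with `c = 0`).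
[cite: Zhao2025MertensMean, Thm 2 and §4 (case 1/2 < Θ < 1)] -/
theorem frequently_integral_E₃_lt_zero_of_not_RH (hRH : ¬ RiemannHypothesis)
    (hstrip : ∃ δ : ℝ, 0 < δ ∧ ∀ ρ : ℂ, riemannZeta ρ = 0 → 0 < ρ.re → ρ.re < 1 → ρ.re ≤ 1 - δ) :
    ∃ᶠ X : ℝ in atTop, ∫ x in (2 : ℝ)..X, E₃ x < 0 := by
  obtain ⟨ρ₀, hζ₀, hρ₀⟩ := exists_zero_of_not_RH hRH
  refine (frequently_integral_E₃_lt_neg_rpow_of_zero hstrip hζ₀ hρ₀ (c := 0) (by linarith)).mono ?_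
  intro X hX
  rw [Real.rpow_zero] at hX
  linarith

/-- **Thm 2, clause 2, negative half PROVED**: if RH fails and the non-trivial zeros stay at distance `≥ δ > 0`
from `Re s = 1` (`1/2 < Θ < 1`), then `∫₂^X E₃(x) dx < 0` for some `X ≥ X₀`, for every `X₀` — the second conjunct
of clause 2 of the named fact `Zhao2025MertensMean_thm2`. [cite: Zhao2025MertensMean, Thm 2 (1/2 < Θ < 1), negative half] -/
theorem thm2_clause2_neg_of_not_RH (hRH : ¬ RiemannHypothesis)
    (hstrip : ∃ δ : ℝ, 0 < δ ∧ ∀ ρ : ℂ, riemannZeta ρ = 0 → 0 < ρ.re → ρ.re < 1 → ρ.re ≤ 1 - δ)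
    (X₀ : ℝ) : ∃ X : ℝ, X₀ ≤ X ∧ ∫ x in (2 : ℝ)..X, E₃ x < 0 :=
  Filter.frequently_atTop.1 (frequently_integral_E₃_lt_zero_of_not_RH hRH hstrip) X₀

/-- **Thm 2, clause 2 («changes sign infinitely often») PROVED**: under `¬RH` and a zero-free strip
`Re ρ ≤ 1 − δ`, `∫₂^X E₃(x) dx` is `> 0` and `< 0` beyond every `X₀` (positive half:
`thm2_clause2_pos_of_not_RH`, from `¬RH` alone). [cite: Zhao2025MertensMean, Thm 2 (1/2 < Θ < 1)] -/
theorem integral_E₃_changes_sign_of_not_RH (hRH : ¬ RiemannHypothesis)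
    (hstrip : ∃ δ : ℝ, 0 < δ ∧ ∀ ρ : ℂ, riemannZeta ρ = 0 → 0 < ρ.re → ρ.re < 1 → ρ.re ≤ 1 - δ)
    (X₀ : ℝ) :
    (∃ X : ℝ, X₀ ≤ X ∧ 0 < ∫ x in (2 : ℝ)..X, E₃ x) ∧ (∃ X : ℝ, X₀ ≤ X ∧ ∫ x in (2 : ℝ)..X, E₃ x < 0) :=
  ⟨thm2_clause2_pos_of_not_RH hRH hstrip X₀, thm2_clause2_neg_of_not_RH hRH hstrip X₀⟩

end Zhao2025

/-! ### The named fact, discharged -/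

/-- **DISCHARGE of `Zhao2025MertensMean_thm2`** (Zhao 2025, Thm 2, the clauses with `Θ < 1`, AS TYPED): clause 1
(`Θ = 1/2`, i.e. RH ⟹ `∫₂^X E₃ > 0` for all `X > 2`) is `Zhao2025MertensMean_thm2_clause1`
(`MertensErrorTermsMeanValueRHThm2Clause1.lean`); clause 2 (`1/2 < Θ < 1`, i.e. `¬RH` and a zero-free strip ⟹ sign
changes beyond every `X₀`) is `Zhao2025.thm2_clause2_pos_of_not_RH` (`MertensErrorTermsMeanValueRHPiLiLandau.lean`) and
`Zhao2025.thm2_clause2_neg_of_not_RH` (this file). RH-CONDITIONAL / conditional on a failure of RH; nothing here bears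
on the truth of RH. [cite: Zhao2025MertensMean, Thm 2] -/
theorem Zhao2025MertensMean_thm2_holds : Zhao2025MertensMean_thm2 :=
  ⟨Zhao2025MertensMean_thm2_clause1, fun hRH hstrip ↦
    ⟨Zhao2025.thm2_clause2_pos_of_not_RH hRH hstrip, Zhao2025.thm2_clause2_neg_of_not_RH hRH hstrip⟩⟩

/-! ### The printed hypothesis «`1/2 < Θ < 1`», `Θ = sup Re ρ`, verbatim -/

/-- **Thm 2, second case, with the printed hypothesis «`1/2 < Θ < 1`» read literally**: let `S` be the set of real parts
of the zeros of `ζ` with `1/2 < Re ρ < 1` (by the functional equation the printed `Θ = sup{Re ρ : ζ(ρ) = 0}` over the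
non-trivial zeros is `max(1/2, sup S)`, so «`1/2 < Θ`» says `S ≠ ∅` and then `Θ = sup S`). If `S` is non-empty and
`sup S < 1`, then `∫₂^X E₃(x) dx` changes sign beyond every `X₀`. (Reduction to the typed clause: `S ≠ ∅` refutes RH,
and `δ = 1 − sup S` is a zero-free strip.) [cite: Zhao2025MertensMean, Thm 2 (1/2 < Θ < 1)] -/
theorem Zhao2025MertensMean_thm2_clause2_of_sSup
    (hne : ((fun ρ : ℂ ↦ ρ.re) '' {ρ : ℂ | riemannZeta ρ = 0 ∧ 1 / 2 < ρ.re ∧ ρ.re < 1}).Nonempty)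
    (hΘ1 : sSup ((fun ρ : ℂ ↦ ρ.re) '' {ρ : ℂ | riemannZeta ρ = 0 ∧ 1 / 2 < ρ.re ∧ ρ.re < 1}) < 1) (X₀ : ℝ) :
    (∃ X : ℝ, X₀ ≤ X ∧ 0 < ∫ x in (2 : ℝ)..X, Zhao2025.E₃ x) ∧
      (∃ X : ℝ, X₀ ≤ X ∧ ∫ x in (2 : ℝ)..X, Zhao2025.E₃ x < 0) := by
  set S : Set ℝ := (fun ρ : ℂ ↦ ρ.re) '' {ρ : ℂ | riemannZeta ρ = 0 ∧ 1 / 2 < ρ.re ∧ ρ.re < 1} with hS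
  obtain ⟨β, ⟨ρ₀, ⟨hζ₀, hρ₀, hρ₀1⟩, rfl⟩⟩ := hne
  have hbdd : BddAbove S := ⟨1, by rintro _ ⟨ρ, ⟨-, -, h⟩, rfl⟩; exact h.le⟩
  have hmem₀ : ρ₀.re ∈ S := ⟨ρ₀, ⟨hζ₀, hρ₀, hρ₀1⟩, rfl⟩
  have hΘhalf : 1 / 2 < sSup S := lt_of_lt_of_le hρ₀ (le_csSup hbdd hmem₀)
  -- `S ≠ ∅` refutes RH
  have hRH : ¬ RiemannHypothesis := by
    intro h
    have htriv : ¬ ∃ n : ℕ, ρ₀ = -2 * (n + 1) := by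
      rintro ⟨n, hn⟩
      have : ρ₀.re = -2 * (n + 1) := by
        rw [hn]
        simp [Complex.mul_re]
      have hn0 : (0 : ℝ) ≤ n := n.cast_nonneg
      linarith
    have h1 : ρ₀ ≠ 1 := fun h1 ↦ by
      rw [h1, Complex.one_re] at hρ₀1
      exact lt_irrefl _ hρ₀1
    have := h ρ₀ hζ₀ htriv h1
    linarith
  -- `δ = 1 − sup S` is a zero-free strip
  have hstrip : ∃ δ : ℝ, 0 < δ ∧ ∀ ρ : ℂ, riemannZeta ρ = 0 → 0 < ρ.re → ρ.re < 1 → ρ.re ≤ 1 - δ := by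
    refine ⟨1 - sSup S, by linarith, fun ρ hζ _ h1 ↦ ?_⟩
    rw [sub_sub_cancel]
    rcases le_or_gt ρ.re (1 / 2) with h | h
    · linarith
    · exact le_csSup hbdd ⟨ρ, ⟨hζ, h, h1⟩, rfl⟩
  exact Zhao2025.integral_E₃_changes_sign_of_not_RH hRH hstrip X₀

/-- Conversely, the typed hypothesis of clause 2 («RH fails and the non-trivial zeros keep a distance `δ > 0` from
`Re s = 1`») gives the printed one: `S ≠ ∅` and `sup S ≤ 1 − δ < 1`. So the typed clause 2 and the `sup` reading are the
same statement. [cite: Zhao2025MertensMean, Thm 2 (1/2 < Θ < 1)] -/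
theorem Zhao2025MertensMean_thm2_sSup_lt_one_of_strip (hRH : ¬ RiemannHypothesis)
    (hstrip : ∃ δ : ℝ, 0 < δ ∧ ∀ ρ : ℂ, riemannZeta ρ = 0 → 0 < ρ.re → ρ.re < 1 → ρ.re ≤ 1 - δ) :
    ((fun ρ : ℂ ↦ ρ.re) '' {ρ : ℂ | riemannZeta ρ = 0 ∧ 1 / 2 < ρ.re ∧ ρ.re < 1}).Nonempty ∧
      sSup ((fun ρ : ℂ ↦ ρ.re) '' {ρ : ℂ | riemannZeta ρ = 0 ∧ 1 / 2 < ρ.re ∧ ρ.re < 1}) < 1 := by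
  obtain ⟨ρ₀, hζ₀, hρ₀⟩ := Zhao2025.exists_zero_of_not_RH hRH
  obtain ⟨δ, hδ0, hδ⟩ := hstrip
  have hρ₀1 : ρ₀.re < 1 := by
    by_contra h
    exact riemannZeta_ne_zero_of_one_le_re (not_lt.1 h) hζ₀
  have hne : ((fun ρ : ℂ ↦ ρ.re) '' {ρ : ℂ | riemannZeta ρ = 0 ∧ 1 / 2 < ρ.re ∧ ρ.re < 1}).Nonempty :=
    ⟨ρ₀.re, ρ₀, ⟨hζ₀, hρ₀, hρ₀1⟩, rfl⟩
  refine ⟨hne, lt_of_le_of_lt (csSup_le hne ?_) (by linarith : 1 - δ < 1)⟩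
  rintro β ⟨ρ, ⟨hζ, h1, h2⟩, rfl⟩
  exact hδ ρ hζ (by linarith) h2

end Literature.NumberTheory.LFunctions

end
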